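import Summits.RiemannHypothesis.RiemannHypothesis.Theorems.LiTailMidpointPrimeTailUniform
import Summits.RiemannHypothesis.RiemannHypothesis.Theorems.LiTailLaguerreLiTailContour
import Summits.RiemannHypothesis.RiemannHypothesis.Theorems.LiTailLaguerreLiTailHorizontal
import Summits.RiemannHypothesis.RiemannHypothesis.Theorems.LiTailLaguerreLiGammaTailShift
import Summits.RiemannHypothesis.RiemannHypothesis.Theorems.LiTailLaguerrePolarTail
import Summits.RiemannHypothesis.RiemannHypothesis.Theorems.LiTailLaguerreTailAdjust
import Summits.RiemannHypothesis.RiemannHypothesis.Theorems.LiTailLaguerreFejerPieces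
import HarnessLib

/-!
# RiemannHypothesis / LiTailMidpoint — the Li ZERO TAIL uniformly in the cut between two resonances: the UNIFORM BRIDGE LAW
# (RH-FREE for all `n`; banked round-9 material of the LI column)

RH-FREE [rh-li-prover g7].  Cell `pub/rh-li`, LI column of the RH ladder (D-0040/D-0061); the CLOSED routes
`Theses/LiTailLaguerre.lean` (round 7, leaf `LiZeroTailLaguerre`: cuts OFF the resonances) and `Theses/LiTailMidpoint.lean` (round 8,
leaf `LiZeroTailMidpoint`: the cut AT a resonance `c_m√n`) both evaluate the Li-weighted zeros above ONE cut per `n`.  The booked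
round-9 target («uniform tail–Fresnel law», `TARGETS.md` §15.5 seed (i); eng-6 g4 exhibits 3/4) asks for EVERY cut in a window around
the resonance.  THIS FILE proves the zero-side half of it, the UNIFORM BRIDGE LAW:

* `liZeroTail_uniform` — for `m ≥ 2` and scales `0 < c₁`, `0 < c₂` with `1/c₁² < log(m+1)`, `log(m−1) < 1/c₂²` (the window
  `[c₁, c₂]` lies strictly between the neighbouring resonant scales `c_{m+1} < c₁`, `c₂ < c_{m−1}`) there are `N`, `C` with
  `|liZeroTail n T − liSmoothTail n T + Σ_{k ∈ Ico 2 m} liCoffeyTerm k n + (Λ(m)/π) m^{−1/2} liBridgeTail n (log m) T| ≤ C log² n`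
  for all `n ≥ N` and EVERY cut `T ∈ [c₁√n, c₂√n]`.

In words: between two resonances, the zeros above the cut (minus their Riemann–von Mangoldt mean) equal MINUS the Laguerre terms of
the prime powers below `m` MINUS `m`'s PARTIAL LAGUERRE BRIDGE above the cut, `(Λ(m)/π) m^{−1/2} ∫_T^∞ 2(1 − cos nθ(t)) cos(t log m) dt`,
uniformly in the cut.  The bridge is explicit and RH-free; `BridgeUniform.liBridgeTail_uniform` (eng-4 g6) evaluates it through the
Fresnel transition (composition in `Theorems/LiTailMidpointFresnelLaw.lean`).  The round-7 leaf off resonance (bridge `→` complete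
bridge `= π m^{−1/2}·(1/…)`-Laguerre term or `→ 0`) and the round-8 leaf at resonance (bridge `=` half) are the two limits.

Proof = the round-7/8 half-strip bookkeeping, whose pieces are ALREADY uniform on `[c√n, n]` in the tree: at a good height
`T' ∈ [T, T + 1]` (`liTailHorizontal_proof c₁`, horizontal edge `O(log² n)`), `liZeroTail = liPolarTail + liGammaTail − liPrimeTail +
liHorizTail` (`liTailContour_proof`), `liPolarTail = O(log n)` (`liPolarTailBound c₁`), `liGammaTail − liSmoothTail = O(log n)`
(`liGammaTailShift_proof c₁`), the prime tail at `T'` is `Σ_{k<m} liCoffeyTerm k n + (Λ(m)/π) m^{−1/2} liBridgeTail n (log m) T' + O(log n)`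
(`PrimeTailUniform.liPrimeTail_uniform`, this seat), and the move from `T` to `T'` costs `O(log n)` on the zero tail (zero count in a
unit window, Li weights `≤ e^{1/(2c₁²)}` WHATEVER the real parts: `TailAdjust.abs_liZeroTail_sub_le`), `O(log n)` on the smooth tail
(`TailAdjust.abs_integral_unit_le`) and `≤ 4` on the bridge (`abs_liBridgeTail_sub_le`).  RH-FREE for all `n` exactly as PART K/M:
every zero above the cut is summed whatever its real part; nothing here bears on the truth of RH; no data of record is added or changed.
-/

noncomputable section

-- D-0017: `Summit.<S>.<S>.…` is the designed namespace of a single-problem summit.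
set_option linter.dupNamespace false

open MeasureTheory intervalIntegral Set
open scoped ArithmeticFunction.vonMangoldt Interval

namespace Summit.RiemannHypothesis.RiemannHypothesis.Theorems.LiTheory

open Literature.NumberTheory.LFunctions

namespace ZeroTailUniform

/-! ### Unit steps of the cut -/

/-- The partial bridge moves by at most `4` per unit of cut: `|liBridgeTail n y a − liBridgeTail n y b| ≤ 4(b − a)` for
`0 ≤ a ≤ b` (`|2(1 − cos nθ) cos(ty)| ≤ 4`). -/
theorem abs_liBridgeTail_sub_le (n : ℕ) (y : ℝ) {a b : ℝ} (ha : 0 ≤ a) (hab : a ≤ b) :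
    |liBridgeTail n y a - liBridgeTail n y b| ≤ 4 * (b - a) := by
  have hb : 0 ≤ b := ha.trans hab
  have hint : ∀ {L : ℝ}, 0 ≤ L →
      IntervalIntegrable (fun t : ℝ ↦ 2 * (1 - Real.cos (n * liZeroAngle t)) * Real.cos (t * y)) volume 0 L :=
    fun hL ↦ (intervalIntegrable_iff_integrableOn_Ioc_of_le hL).2
      ((Fejer.integrableOn_bridge n y).mono_set Ioc_subset_Ioi_self)
  have h1 := Fejer.bridge_split n y ha
  have h2 := Fejer.bridge_split n y hb
  have hsub : liBridgeTail n y a - liBridgeTail n y b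
      = ∫ t in a..b, 2 * (1 - Real.cos (n * liZeroAngle t)) * Real.cos (t * y) := by
    unfold liBridgeTail
    rw [← integral_interval_sub_left (hint hb) (hint ha)]
    linarith
  rw [hsub]
  have hpt : ∀ t ∈ Ι a b, ‖2 * (1 - Real.cos (n * liZeroAngle t)) * Real.cos (t * y)‖ ≤ 4 := by
    intro t _
    obtain ⟨hw0, hw2⟩ := SmoothReplace.liWindowWeight_mem n t
    unfold liWindowWeight at hw0 hw2
    have hc : |Real.cos (t * y)| ≤ 1 := Real.abs_cos_le_one _
    rw [Real.norm_eq_abs, abs_mul, abs_mul, abs_two, abs_of_nonneg hw0]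
    nlinarith [abs_nonneg (Real.cos (t * y))]
  have h := norm_integral_le_of_norm_le_const hpt
  rwa [Real.norm_eq_abs, abs_of_nonneg (by linarith : (0 : ℝ) ≤ b - a)] at h

/-- For `c > 0` and `n ≥ ⌈(c + 3)²⌉₊`: `c√n + 3 ≤ n` and `3 ≤ n` (room above the window for the good height and the count). -/
theorem window_room {c : ℝ} (hc : 0 < c) {n : ℕ} (hn : ⌈(c + 3) ^ 2⌉₊ ≤ n) :
    c * Real.sqrt n + 3 ≤ n ∧ (3 : ℝ) ≤ n := by
  have hN : (c + 3) ^ 2 ≤ (n : ℝ) := (Nat.le_ceil _).trans (by exact_mod_cast hn)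
  set s := Real.sqrt n with hs
  have hn0 : (0 : ℝ) ≤ n := by positivity
  have hss : s ^ 2 = n := by rw [hs, Real.sq_sqrt hn0]
  have hs3 : c + 3 ≤ s := by
    rw [hs, ← Real.sqrt_sq (by positivity : 0 ≤ c + 3)]; exact Real.sqrt_le_sqrt hN
  have hs1 : 1 ≤ s := by linarith
  have h1 : (c + 3) * s ≤ s * s := mul_le_mul_of_nonneg_right hs3 (by linarith)
  constructor <;> nlinarith

/-! ### The uniform bridge law -/

set_option maxHeartbeats 400000 in
open TailAdjust in
/-- **The Li zero tail uniformly in the cut between two resonances — the UNIFORM BRIDGE LAW** (RH-FREE for all `n`; banked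
round-9 material of the LI column): for `m ≥ 2` and scales `0 < c₁`, `0 < c₂` with `1/c₁² < log(m+1)` and `log(m−1) < 1/c₂²`
there are `N`, `C` with
`|liZeroTail n T − liSmoothTail n T + Σ_{k ∈ Ico 2 m} liCoffeyTerm k n + (Λ(m)/π) m^{−1/2} liBridgeTail n (log m) T| ≤ C log² n`
for all `n ≥ N` and every cut `T` with `c₁√n ≤ T ≤ c₂√n`. -/
theorem liZeroTail_uniform (m : ℕ) (hm : 2 ≤ m) {c₁ c₂ : ℝ} (hc₁ : 0 < c₁) (hc₂ : 0 < c₂)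
    (hlow : 1 / c₁ ^ 2 < Real.log (m + 1 : ℕ)) (hup : Real.log (m - 1 : ℕ) < 1 / c₂ ^ 2) :
    ∃ N : ℕ, ∃ C : ℝ, ∀ n : ℕ, N ≤ n → ∀ T : ℝ,
      c₁ * Real.sqrt n ≤ T → T ≤ c₂ * Real.sqrt n →
        |liZeroTail n T - liSmoothTail n T + (∑ k ∈ Finset.Ico 2 m, liCoffeyTerm k n)
            + (Λ m : ℝ) / Real.pi * (m : ℝ) ^ (-(1 / 2 : ℝ)) * liBridgeTail n (Real.log m) T|
          ≤ C * Real.log n ^ 2 := by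
  have hm0 : (0 : ℝ) < m := by exact_mod_cast (show 0 < m by omega)
  set a : ℝ := (Λ m : ℝ) / Real.pi * (m : ℝ) ^ (-(1 / 2 : ℝ)) with ha_def
  have ha : 0 ≤ a := by
    rw [ha_def]
    exact mul_nonneg (div_nonneg ArithmeticFunction.vonMangoldt_nonneg Real.pi_pos.le) (Real.rpow_nonneg hm0.le _)
  obtain ⟨A, hA0, hA⟩ := Montgomery.exists_zetaZeroCount_add_one_sub_le
  obtain ⟨N₃, C₃, h3⟩ := liPolarTailBound c₁ hc₁
  obtain ⟨N₄, C₄, h4⟩ := liGammaTailShift_proof c₁ hc₁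
  obtain ⟨N₅, C₅, h5⟩ := PrimeTailUniform.liPrimeTail_uniform m hm hc₁ hc₂ hlow hup
  obtain ⟨N₆, C₆, h6⟩ := liTailHorizontal_proof c₁ hc₁
  set κ : ℝ := 1 / c₁ ^ 2 with hκ_def
  have hκ : 0 < κ := by positivity
  set Cz : ℝ := 2 * (1 + Real.exp (κ / 2)) * A with hCz_def
  have hCz0 : 0 ≤ Cz := by positivity
  set ℓ : ℝ := Real.log 2 with hℓ_def
  have hℓ : 0 < ℓ := Real.log_pos (by norm_num)
  refine ⟨max (max (max N₃ N₄) (max N₅ N₆)) (max ⌈1 / c₁ ^ 2⌉₊ ⌈(c₂ + 3) ^ 2⌉₊),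
    (Cz + 7 + |C₃| + |C₄| + |C₅|) / ℓ + 4 * a / ℓ ^ 2 + |C₆|, fun n hn T hTl hTu ↦ ?_⟩
  have hn3 : N₃ ≤ n := by omega
  have hn4 : N₄ ≤ n := by omega
  have hn5 : N₅ ≤ n := by omega
  have hn6 : N₆ ≤ n := by omega
  have hnc₁ : ⌈1 / c₁ ^ 2⌉₊ ≤ n := by omega
  have hnc₂ : ⌈(c₂ + 3) ^ 2⌉₊ ≤ n := by omega
  obtain ⟨hroom, hn3r⟩ := window_room hc₂ hnc₂
  have hcs1 : 1 ≤ c₁ * Real.sqrt n := PrimeTailUniform.one_le_mul_sqrt hc₁ hnc₁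
  have hn1 : 1 ≤ n := by exact_mod_cast (show (1 : ℝ) ≤ n by linarith)
  have hT1 : 1 ≤ T := hcs1.trans hTl
  have hT0 : 0 < T := by linarith
  have hTn : T ≤ n := by linarith
  -- the good height `T' ∈ [T, T + 1]`
  obtain ⟨T', hT'l, hT'u, hgood, hH⟩ := h6 n hn6 T hTl hTn
  have hT'1 : 1 ≤ T' := hT1.trans hT'l
  have hT'c₁ : c₁ * Real.sqrt n ≤ T' := hTl.trans hT'l
  have hT'n : T' ≤ n := by linarith
  have hT'c₂ : T' ≤ c₂ * Real.sqrt n + 1 := by linarith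
  have hid := liTailContour_proof n T' hn1 hT'1 hgood
  have hpol := h3 n hn3 T' hT'c₁ hT'n
  have hgam := h4 n hn4 T' hT'c₁ hT'n
  have hpr := h5 n hn5 T' hT'c₁ hT'c₂
  -- log sizes
  set L : ℝ := Real.log n with hL_def
  have hLℓ : ℓ ≤ L := Real.log_le_log (by norm_num) (by linarith)
  have hL0 : 0 ≤ L := hℓ.le.trans hLℓ
  have hL1 : 1 ≤ L := by
    rw [hL_def, Real.le_log_iff_exp_le (by linarith)]
    have := Real.exp_one_lt_d9; linarith
  -- the three unit steps from `T` to `T'`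
  have hadjZ : |liZeroTail n T - liZeroTail n T'| ≤ Cz * L := by
    have hnT : (n : ℝ) ≤ κ * T ^ 2 := by
      have hsq : Real.sqrt n ^ 2 = n := Real.sq_sqrt (Nat.cast_nonneg n)
      have h1 : c₁ ^ 2 * n ≤ T ^ 2 := by
        have := pow_le_pow_left₀ (by positivity) hTl 2
        rw [mul_pow, hsq] at this; exact this
      rw [hκ_def]
      calc (n : ℝ) = 1 / c₁ ^ 2 * (c₁ ^ 2 * n) := by field_simp
        _ ≤ 1 / c₁ ^ 2 * T ^ 2 := mul_le_mul_of_nonneg_left h1 (by positivity)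
    have h1 := abs_liZeroTail_sub_le n hκ hnT hT0 hT'l
    have hcount : (zetaZeroCount T' : ℝ) - zetaZeroCount T ≤ A * L := by
      have hmono : (zetaZeroCount T' : ℝ) ≤ zetaZeroCount (T + 1) := by exact_mod_cast zetaZeroCount_mono hT'u
      have hstep := hA T hT0.le
      have hlog : Real.log (T + 2) ≤ L := Real.log_le_log (by linarith) (by linarith)
      nlinarith
    calc |liZeroTail n T - liZeroTail n T'|
        ≤ 2 * (1 + Real.exp (κ / 2)) * ((zetaZeroCount T' : ℝ) - zetaZeroCount T) := h1
      _ ≤ 2 * (1 + Real.exp (κ / 2)) * (A * L) := mul_le_mul_of_nonneg_left hcount (by positivity)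
      _ = Cz * L := by rw [hCz_def]; ring
  have hadjS : |liSmoothTail n T - liSmoothTail n T'| ≤ 7 * L := by
    rw [liSmoothTail_sub_eq n hT0 hT'l, abs_mul, abs_of_pos (by positivity : (0 : ℝ) < 2 / Real.pi)]
    have e1 := abs_integral_unit_le n hT1 hT'l hT'u
    have hl1 : Real.log (T + 1) ≤ L := Real.log_le_log (by linarith) (by linarith)
    have hπ : 2 / Real.pi ≤ 1 := by rw [div_le_one Real.pi_pos]; linarith [Real.pi_gt_three]
    have h7 : Real.log (T + 1) + 6 ≤ 7 * L := by linarith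
    calc 2 / Real.pi * |∫ t in T..T', liWindowWeight n t * liGammaDensity t|
        ≤ 1 * (7 * L) := mul_le_mul hπ (e1.trans h7) (abs_nonneg _) zero_le_one
      _ = 7 * L := one_mul _
  have hadjB : |a * (liBridgeTail n (Real.log m) T - liBridgeTail n (Real.log m) T')| ≤ 4 * a := by
    rw [abs_mul, abs_of_nonneg ha, mul_comm (4 : ℝ) a]
    refine mul_le_mul_of_nonneg_left ?_ ha
    exact (abs_liBridgeTail_sub_le n (Real.log m) hT0.le hT'l).trans (by linarith)
  -- bookkeeping
  have key : liZeroTail n T - liSmoothTail n T + (∑ k ∈ Finset.Ico 2 m, liCoffeyTerm k n)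
        + a * liBridgeTail n (Real.log m) T
      = (liZeroTail n T - liZeroTail n T') - (liSmoothTail n T - liSmoothTail n T')
        + liPolarTail n T' + (liGammaTail n T' - liSmoothTail n T')
        - (liPrimeTail n T' - (∑ k ∈ Finset.Ico 2 m, liCoffeyTerm k n) - a * liBridgeTail n (Real.log m) T')
        + a * (liBridgeTail n (Real.log m) T - liBridgeTail n (Real.log m) T')
        + liHorizTail n T' := by
    rw [hid]; ring
  rw [key]
  have hL2 : L ≤ L ^ 2 / ℓ := by
    rw [le_div_iff₀ hℓ, sq]; exact mul_le_mul_of_nonneg_left hLℓ hL0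
  have hone : (1 : ℝ) ≤ L ^ 2 / ℓ ^ 2 := by
    rw [le_div_iff₀ (by positivity), one_mul]
    exact pow_le_pow_left₀ hℓ.le hLℓ 2
  have bZ : Cz * L ≤ Cz * (L ^ 2 / ℓ) := mul_le_mul_of_nonneg_left hL2 hCz0
  have bS : 7 * L ≤ 7 * (L ^ 2 / ℓ) := mul_le_mul_of_nonneg_left hL2 (by norm_num)
  have b3 : C₃ * L ≤ |C₃| * (L ^ 2 / ℓ) :=
    (mul_le_mul_of_nonneg_right (le_abs_self C₃) hL0).trans (mul_le_mul_of_nonneg_left hL2 (abs_nonneg _))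
  have b4 : C₄ * L ≤ |C₄| * (L ^ 2 / ℓ) :=
    (mul_le_mul_of_nonneg_right (le_abs_self C₄) hL0).trans (mul_le_mul_of_nonneg_left hL2 (abs_nonneg _))
  have b5 : C₅ * L ≤ |C₅| * (L ^ 2 / ℓ) :=
    (mul_le_mul_of_nonneg_right (le_abs_self C₅) hL0).trans (mul_le_mul_of_nonneg_left hL2 (abs_nonneg _))
  have bB : 4 * a ≤ 4 * a * (L ^ 2 / ℓ ^ 2) := le_mul_of_one_le_right (by positivity) hone
  have b6 : C₆ * L ^ 2 ≤ |C₆| * L ^ 2 := mul_le_mul_of_nonneg_right (le_abs_self C₆) (sq_nonneg _)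
  have e : ((Cz + 7 + |C₃| + |C₄| + |C₅|) / ℓ + 4 * a / ℓ ^ 2 + |C₆|) * L ^ 2
      = Cz * (L ^ 2 / ℓ) + 7 * (L ^ 2 / ℓ) + |C₃| * (L ^ 2 / ℓ) + |C₄| * (L ^ 2 / ℓ) + |C₅| * (L ^ 2 / ℓ)
        + 4 * a * (L ^ 2 / ℓ ^ 2) + |C₆| * L ^ 2 := by
    ring
  rw [e]
  rw [abs_le] at hadjZ hadjS hadjB hpol hgam hpr hH ⊢
  constructor <;> linarith [hadjZ.1, hadjZ.2, hadjS.1, hadjS.2, hadjB.1, hadjB.2, hpol.1, hpol.2, hgam.1, hgam.2,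
    hpr.1, hpr.2, hH.1, hH.2]

end ZeroTailUniform

end Summit.RiemannHypothesis.RiemannHypothesis.Theorems.LiTheory

end
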